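import Literature.MathematicalPhysics.QuantumFieldTheory.Balaban1983to89.B6Eq2112
import Literature.MathematicalPhysics.QuantumFieldTheory.Balaban1983to89.B6Repr2129
import Literature.MathematicalPhysics.QuantumFieldTheory.Balaban1983to89.B5ChangeOfGauge123

/-!
# `Balaban1983to89.B6Eq2112Assembly` — T. Bałaban, *Propagators and renormalization transformations for lattice gauge
# theories. II*, Commun. Math. Phys. **96** (1984) 223–250 [Balaban1984PropagatorsII], Sect. C (2.95) ⇒ (2.112) ⇒ (2.119)
# ⇒ (2.129) pp. 240–246, ASSEMBLED in the finite-dimensional (Lebesgue = additive Haar) model: the display (2.112) DERIVED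
# from the Gaussian representation (2.95) of `G = Δ_a⁻¹`, and the hypothesis `h2112` of rows B6.Eq2.119 / B6.Eq2.129 discharged

statement-level skeleton of published theorems with citation tags; proofs where landed; nothing here is a claim about the Yang–Mills mass gap

PDF held: `paper:balaban1984-cmp96-propagators-rt-ii` (journal page = PDF page + 222); pp. 240–246 [PDF 18–24] read AS IMAGES on
the ×2 renders `run/shared/lean/pub/pub-balaban/b2b-balaban-ref1/pages/1984-cmp96-propagators-rt-II/` (2026-08-21).
CITATION HEADER (lean-in-tree rule).  WHAT IS REPRODUCED: lit-balaban SKELETON rows **B6.Eq2.112** (derived), **B6.Eq2.119** and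
**B6.Eq2.129** (their displayed hypothesis `h2112` = (2.112) of `…B6GaussianIdentity2119.eq2119` / `…B6Repr2129.eq2129`
discharged from (2.95)).  PHASE-2 seat p22 (gen 7); owner r03, referee ref-4.  IMPORTS, restating nothing: `…B6Eq2112` (this
seat: (2.111) and the pointwise chain), `…B6Repr2129` (gen 2; through it `…B6GaussianIdentity2119`, `…B6Eq295`), `…B5ChangeOfGauge123`
(gen 1: the slice ⊕ orbit change of variables `map_slice_orbit_eq_smul` / `integral_comp_slice_orbit` for linear isomorphisms
of finite-dimensional spaces with Haar measures).

PRINT (pp. 240–243; the full displays are quoted in `…B6Eq2112`).  (2.95) *"e^{½⟨J,GJ⟩} = Z⁻¹∫dA exp[−½⟨QA,aQA⟩ − ½⟨A,(Δ−∂P∂*)A⟩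
+ ⟨A,J⟩] = …"*; (2.96) *"The configurations ω, ω′ are defined on Λ and from the definition of δ_{Ax} we have ∫dω′↾_Λδ(Q′₁ω′)
Π_{y∈Λ′}δ_{Ax(y)}(Q_jA+∂₁ω′) = 1. (2.96) Such an identity was used already in the change of gauge formula (1.23)"*; (2.97);
*"Let us make a gauge transformation in the integral ∫dA… A → A − ∂H′_jω … Taking into account all these changes we get
(2.105)"*; (2.106); *"Calculating these integrals we get (2.111). This implies further e^{½⟨J,GJ⟩} = e^{½⟨J,∂H′_jCH′_j*∂*J⟩}Z⁻¹Z′_j⁻¹Z′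
· ∫dB exp[−½aΣ_{b∈Λ^c}|B(b)|² − ½aL^{d−2}Σ_{c∈Λ′}|(Q₁B)(c)|²]Π_{y∈Λ′}δ_{Ax(y)}(B) · ∫dAδ(Q_jA−B) exp[−½⟨A,(Δ−∂P_j∂*)A⟩
+ ⟨A, J − ∂ΔH′_jCH′_j*∂*J⟩]. (2.112)"*; (2.119) p. 243 and (2.129) p. 246 as quoted in `…B6GaussianIdentity2119` / `…B6Repr2129`.

TYPING — THE MODEL.  All spaces are finite-dimensional real inner-product / normed spaces with their Borel σ-algebras; `dA`,
`dB`, `dω`, the gauge-fixed `dA`, `dA↾{Q_jA = B}` are ADDITIVE HAAR (= Lebesgue) measures `μA`, `νB`, `ν`, `μS`, `μN`; ALL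
δ-functions are typed as constraint subspaces carrying such measures (the convention of `…B6Eq295` §1/§4,
`…B6GaussianIdentity2119`, `…B6Repr2129`, `…B5ChangeOfGauge123`):
* `∫dA Π_{y∈Λ′}δ_{Ax(y)}(Q_jA)(·)` = `∫ (·)(σ s) dμS` over the gauge-fixed configurations (`σ : S → A` linear);
* (2.96) *"exactly one admissible ω′ per configuration"* (existence and uniqueness of the block axial gauge, [4] Sect. B;
  kernel-checked elsewhere as `…B5.HierGauge.complete/unique`, unit Jacobian `…B6Eq296UnitJacobian`) is the DATUM
  `e₁ : N1 × S ≃L[ℝ] A`, `e₁(ω, A′) = A′ − ∂H′_jω` (`he₁`): every configuration is `A′ − ∂H′_jω` for exactly one admissible `ω`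
  and one gauge-fixed `A′` — so `∫dA F(A) = c₁⁻¹∫dω↾_Λδ(Q′₁ω)∫dA′Πδ_{Ax(y)}(Q_jA′) F(A′ − ∂H′_jω)`, `c₁ > 0` a Haar scalar factor
  (`…B5ChangeOfGauge123.integral_comp_slice_orbit`; `c₁ = 1` for Lebesgue normalisations by (2.96), not used), and at fixed `ω`
  the substitution `A = A′ − ∂H′_jω` IS print's gauge transformation (`…B6Eq2112.integrand_297_eq_2105`);
* `∫dB Πδ_{Ax(y)}(B) ∫dAδ(Q_jA − B)(·)` = `∫∫ (·)(ι_A n + H_jι_B m) dμN dνB` (`ι_B : NB → Bs` onto the axial-gauge `B`'s, `ι_A : N → A`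
  onto `{Q_jA = 0}` (`hιA`), `Q_jH_j = I` (`hHj`), exactly as in `…B6GaussianIdentity2119.eq2119`), and `dA′ = dB·dA↾{Q_jA = B}` is
  the DATUM `e₂ : NB × N ≃L[ℝ] S`, `σ(e₂(m, n)) = ι_A n + H_jι_B m` (`he₂`), contributing a second Haar scalar factor `c₂ > 0`;
* the remaining δ-integrals (`dλδ(Q′λ)` over `NQ`, `dλ′δ(Q′_jλ′)` over `Nj`) stay abstract left-invariant as in `…B6Eq2112`, with
  the remark *"∫dω′↾_Λδ(Q′₁ω′)δ(Q′_jλ′ − ω′) = δ(Q′λ′)"* displayed (`hX`, constant `cX`) and `Z′, Z′_j, Z_C ≠ 0` displayed;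
* Fubini is used twice and needs absolute convergence: `hint₁` (the (2.95) integrand is `dA`-integrable — it is the Gaussian
  `e^{−½⟨A,Δ_aA⟩+⟨A,J⟩}`) and `hint₂` (the (2.112) integrand is integrable over the gauge-fixed configurations).
Everything else (operators, adjoints, (2.98)–(2.104) data, `C^{(j)}_Λ`, `G = Δ_a⁻¹` as a right inverse `hG`) is as in `…B6Eq2112`.

CONTENTS (theorems only; 0 defs; standard axioms).  §1 `starProjection_symm_form`, `Mj_symm` (`Δ − ∂P_j∂*` symmetric),
`deltaA_symm` (`Δ_a` of (2.19) symmetric), `integrable_comp_equiv` (integrability transported along `e₁`, `e₂`).  §2 **`eq2112`**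
— (2.95) ⇒ (2.112): `e^{½⟨J,GJ⟩}·Z = c · e^{½⟨J,K₁J⟩} ∫dBΠδ_{Ax}(B) e^{−½⟨Q″B,aQ″B⟩} ∫dAδ(Q_jA−B) exp[−½⟨A,(Δ−∂P_j∂*)A⟩ + ⟨A,J−K₂J⟩]`
with the constant `c = c₁⁻¹·Z′Z′_j⁻¹cX⁻¹·c₂⁻¹` (print: `Z⁻¹Z′_j⁻¹Z′` after dividing by `Z`; the Haar factors are `1` for Lebesgue
normalisations); §3 **`eq2112_normalised`** (divided by `Z ≠ 0`: EXACTLY the hypothesis `h2112` of `eq2119`/`eq2129`);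
**`eq2119_of_295`** ((2.119) from (2.95): `…B6GaussianIdentity2119.eq2119` with `h2112` discharged); **`eq2129_of_295`**
((2.129) from (2.95): `…B6Repr2129.eq2129` with `h2112` discharged, hypotheses quantified over the source `J`).
HONEST SCOPE: a finite-dimensional Haar model with displayed hypotheses (integrability, non-vanishing normalisations, the two
linear isomorphisms as data); the value is a kernel certificate that the printed steps (2.95)–(2.112) compose with the right
constants and sources, NOT summit progress.  Unit `lit-balaban-p22` (gen 7), HOME `run/shared/lean/pub/lit-balaban/`, 2026-08-21.
-/

noncomputable section

open MeasureTheory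
open scoped InnerProductSpace

namespace Literature.MathematicalPhysics.QuantumFieldTheory.Balaban1983to89.B6Eq2112Assembly

/-! ## §1  Symmetry of `Δ − ∂P_j∂*` and of `Δ_a`; integrability along a linear change of variables -/

section Symm

variable {A B V : Type*} [NormedAddCommGroup A] [InnerProductSpace ℝ A] [NormedAddCommGroup B] [InnerProductSpace ℝ B]
  [NormedAddCommGroup V] [InnerProductSpace ℝ V]

/-- The form `⟨A, ∂P∂*A′⟩ = ⟨∂*A, ∂*A′⟩ − ⟨R∂*A, ∂*A′⟩` for `P = I − R`, `R` an orthogonal projection, `∂*` (`dv`) the adjoint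
of `∂` (`grad`) — symmetric in `A, A′`. [cite: Balaban1984PropagatorsII, (2.19) p.226] -/
theorem starProjection_symm_form (K : Submodule ℝ B) [K.HasOrthogonalProjection] (P : B →ₗ[ℝ] B)
    (hPK : ∀ g, P g = g - K.starProjection g) (grad : B →ₗ[ℝ] A) (dv : A →ₗ[ℝ] B)
    (hgrad : ∀ (b : B) (x : A), ⟪grad b, x⟫_ℝ = ⟪b, dv x⟫_ℝ) (x y : A) :
    ⟪grad (P (dv x)), y⟫_ℝ = ⟪x, grad (P (dv y))⟫_ℝ := by
  have h1 : ⟪grad (P (dv x)), y⟫_ℝ = ⟪dv x, dv y⟫_ℝ - ⟪K.starProjection (dv x), dv y⟫_ℝ := by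
    rw [hgrad, hPK, inner_sub_left]
  have h2 : ⟪x, grad (P (dv y))⟫_ℝ = ⟪dv y, dv x⟫_ℝ - ⟪K.starProjection (dv y), dv x⟫_ℝ := by
    rw [← real_inner_comm, hgrad, hPK, inner_sub_left]
  rw [h1, h2, Submodule.inner_starProjection_left_eq_right, real_inner_comm (dv x) (dv y),
    real_inner_comm (K.starProjection (dv y)) (dv x)]

/-- `Δ − ∂P_j∂*` (vector fields; `P_j = I − R_j`) is symmetric when `Δ` is. [cite: Balaban1984PropagatorsII, (2.112) p.243] -/
theorem Mj_symm (Kj : Submodule ℝ B) [Kj.HasOrthogonalProjection] (Pj : B →ₗ[ℝ] B)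
    (hPj : ∀ g, Pj g = g - Kj.starProjection g) (lapV : A →ₗ[ℝ] A) (grad : B →ₗ[ℝ] A) (dv : A →ₗ[ℝ] B)
    (hlapVsym : ∀ x y : A, ⟪lapV x, y⟫_ℝ = ⟪x, lapV y⟫_ℝ) (hgrad : ∀ (b : B) (x : A), ⟪grad b, x⟫_ℝ = ⟪b, dv x⟫_ℝ)
    (x y : A) : ⟪(lapV - grad ∘ₗ Pj ∘ₗ dv) x, y⟫_ℝ = ⟪x, (lapV - grad ∘ₗ Pj ∘ₗ dv) y⟫_ℝ := by
  simp only [LinearMap.sub_apply, LinearMap.comp_apply, inner_sub_left, inner_sub_right]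
  rw [hlapVsym, starProjection_symm_form Kj Pj hPj grad dv hgrad]

/-- `Δ_a = Δ − ∂P∂* + Q*aQ` of (2.19) (`…B6SectA.deltaA`) is symmetric (`Q*` the adjoint of `Q`, `a` symmetric, `Δ` symmetric,
`P = I − R`) — the hypothesis `hsym` of `…B6Eq295.eq295_first`. [cite: Balaban1984PropagatorsII, (2.19) p.226, (2.95) p.240] -/
theorem deltaA_symm (K : Submodule ℝ B) [K.HasOrthogonalProjection] (P : B →ₗ[ℝ] B)
    (hPK : ∀ g, P g = g - K.starProjection g) (lapV : A →ₗ[ℝ] A) (grad : B →ₗ[ℝ] A) (dv : A →ₗ[ℝ] B)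
    (Q : A →ₗ[ℝ] V) (Qs : V →ₗ[ℝ] A) (a : V →ₗ[ℝ] V) (hlapVsym : ∀ x y : A, ⟪lapV x, y⟫_ℝ = ⟪x, lapV y⟫_ℝ)
    (hgrad : ∀ (b : B) (x : A), ⟪grad b, x⟫_ℝ = ⟪b, dv x⟫_ℝ) (hQ : ∀ (w : V) (v : A), ⟪Qs w, v⟫_ℝ = ⟪w, Q v⟫_ℝ)
    (ha : ∀ x y : V, ⟪a x, y⟫_ℝ = ⟪x, a y⟫_ℝ) (x y : A) :
    ⟪B6SectA.deltaA lapV grad dv P Q Qs a x, y⟫_ℝ = ⟪x, B6SectA.deltaA lapV grad dv P Q Qs a y⟫_ℝ := by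
  have hQ' : ∀ (v : A) (w : V), ⟪v, Qs w⟫_ℝ = ⟪Q v, w⟫_ℝ := fun v w => by rw [real_inner_comm, hQ, real_inner_comm]
  simp only [B6SectA.deltaA, LinearMap.add_apply, LinearMap.sub_apply, LinearMap.comp_apply, inner_add_left,
    inner_sub_left, inner_add_right, inner_sub_right]
  rw [hlapVsym, starProjection_symm_form K P hPK grad dv hgrad, hQ, ha, hQ']

end Symm

section Transport

variable {M₀ Λ N : Type*}
  [NormedAddCommGroup M₀] [NormedSpace ℝ M₀] [FiniteDimensional ℝ M₀] [MeasurableSpace M₀] [BorelSpace M₀]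
  [NormedAddCommGroup Λ] [NormedSpace ℝ Λ] [FiniteDimensional ℝ Λ] [MeasurableSpace Λ] [BorelSpace Λ]
  [NormedAddCommGroup N] [NormedSpace ℝ N] [FiniteDimensional ℝ N] [MeasurableSpace N] [BorelSpace N]

/-- Absolute convergence transported along a linear change of variables `e : M₀ × Λ ≃ N` of finite-dimensional spaces with
Haar (Lebesgue) measures: `G` integrable `dμ` ⇒ `G ∘ e` integrable `d(μ₀ ⊗ ν)` (the image measure is a positive multiple of
`μ`, `…B5ChangeOfGauge123.map_slice_orbit_eq_smul`) — what Fubini needs below. [cite: Balaban1984PropagatorsII, (2.96)–(2.97) p.240] -/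
theorem integrable_comp_equiv (μ₀ : Measure M₀) (ν : Measure Λ) (μ : Measure N) [μ₀.IsAddHaarMeasure]
    [ν.IsAddHaarMeasure] [μ.IsAddHaarMeasure] (e : (M₀ × Λ) ≃L[ℝ] N) (G : N → ℝ) (hG : Integrable G μ) :
    Integrable (fun p => G (e p)) (μ₀.prod ν) := by
  have h1 : Integrable G ((μ₀.prod ν).map e) := by
    rw [B5ChangeOfGauge123.map_slice_orbit_eq_smul μ₀ ν μ e]
    exact hG.smul_measure_nnreal
  rw [← show ((e.toHomeomorph.toMeasurableEquiv : (M₀ × Λ) ≃ᵐ N) : (M₀ × Λ) → N) = e from rfl] at h1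
  exact (integrable_map_equiv e.toHomeomorph.toMeasurableEquiv G).1 h1

end Transport

/-! ## §2  (2.95) ⇒ (2.112) in the Haar model -/

section Model

variable {A B W T Bs V Nj NQ N1 S NB N : Type*}
  [NormedAddCommGroup A] [InnerProductSpace ℝ A] [FiniteDimensional ℝ A] [MeasurableSpace A] [BorelSpace A]
  [NormedAddCommGroup B] [InnerProductSpace ℝ B] [NormedAddCommGroup W] [InnerProductSpace ℝ W]
  [NormedAddCommGroup T] [InnerProductSpace ℝ T] [NormedAddCommGroup Bs] [InnerProductSpace ℝ Bs]
  [NormedAddCommGroup V] [InnerProductSpace ℝ V]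
  [AddCommGroup Nj] [Module ℝ Nj] [MeasurableSpace Nj] [MeasurableAdd Nj]
  [AddCommGroup NQ] [Module ℝ NQ] [MeasurableSpace NQ] [MeasurableAdd NQ]
  [NormedAddCommGroup N1] [NormedSpace ℝ N1] [FiniteDimensional ℝ N1] [MeasurableSpace N1] [BorelSpace N1]
  [NormedAddCommGroup S] [NormedSpace ℝ S] [FiniteDimensional ℝ S] [MeasurableSpace S] [BorelSpace S]
  [NormedAddCommGroup NB] [NormedSpace ℝ NB] [FiniteDimensional ℝ NB] [MeasurableSpace NB] [BorelSpace NB]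
  [NormedAddCommGroup N] [NormedSpace ℝ N] [FiniteDimensional ℝ N] [MeasurableSpace N] [BorelSpace N]

/- THE DATA OF THE MODEL (shared by the four theorems of §§2–3; meanings in the module docstring and in `…B6Eq2112`):
the Haar (Lebesgue) measures `dA`, `dω`, gauge-fixed `dA′`, `dB`, `dA↾{Q_jA = B}`; the abstract left-invariant `dλ′δ(Q′_jλ′)`,
`dλδ(Q′λ)`; `Δ` on scalars, the constraints `N(Q′)`/`N(Q′_j)` with `P = I − R`, `P_j = I − R_j`; `Δ, ∂, ∂*` on vector fields;
`Q = Q″Q_j`, `Q*`, `a`, `G = Δ_a⁻¹`; `H′_j`, the admissible `ω`, (2.103)/(2.104), (2.98), `λ₀ ∈ N(Q′)`; `C^{(j)}_Λ`; the remark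
on `δ(Q′λ)` (`hX`) and `Z′, Z′_j ≠ 0`; (2.96) = `e₁`; `dA′ = dB·dA↾{Q_jA = B}` = `e₂`. -/
variable
    (μA : Measure A) [μA.IsAddHaarMeasure] (ν : Measure N1) [ν.IsAddHaarMeasure] (μS : Measure S) [μS.IsAddHaarMeasure]
    (νB : Measure NB) [νB.IsAddHaarMeasure] (μN : Measure N) [μN.IsAddHaarMeasure]
    (μj : Measure Nj) [μj.IsAddLeftInvariant] (μ' : Measure NQ) [μ'.IsAddLeftInvariant]
    (lap : B →ₗ[ℝ] B) (hlap : ∀ x y : B, ⟪lap x, y⟫_ℝ = ⟪x, lap y⟫_ℝ) (κ : NQ →ₗ[ℝ] B) (ι : Nj →ₗ[ℝ] B)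
    (K : Submodule ℝ B) [K.HasOrthogonalProjection] (hK : LinearMap.range (lap ∘ₗ κ) = K)
    (P : B →ₗ[ℝ] B) (hPK : ∀ g, P g = g - K.starProjection g)
    (Kj : Submodule ℝ B) [Kj.HasOrthogonalProjection] (hKj : LinearMap.range (lap ∘ₗ ι) = Kj)
    (Rj Pj : B →ₗ[ℝ] B) (hRj : ∀ g, Rj g = Kj.starProjection g) (hPj : ∀ g, Pj g = g - Kj.starProjection g)
    (lapV : A →ₗ[ℝ] A) (curl : A →ₗ[ℝ] T) (grad : B →ₗ[ℝ] A) (dv : A →ₗ[ℝ] B)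
    (hlapVsym : ∀ x y : A, ⟪lapV x, y⟫_ℝ = ⟪x, lapV y⟫_ℝ)
    (hlapV : ∀ v : A, ⟪v, lapV v⟫_ℝ = ‖curl v‖ ^ 2 + ‖dv v‖ ^ 2)
    (hgrad : ∀ (b : B) (x : A), ⟪grad b, x⟫_ℝ = ⟪b, dv x⟫_ℝ) (hΔ : ∀ b : B, dv (grad b) = lap b)
    (hcurl : ∀ b : B, curl (grad b) = 0)
    (Qv : A →ₗ[ℝ] Bs) (Qpp : Bs →ₗ[ℝ] V) (Qs : V →ₗ[ℝ] A) (a : V →ₗ[ℝ] V)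
    (hQ : ∀ (w : V) (v : A), ⟪Qs w, v⟫_ℝ = ⟪w, Qpp (Qv v)⟫_ℝ) (ha : ∀ x y : V, ⟪a x, y⟫_ℝ = ⟪x, a y⟫_ℝ)
    (G : A →ₗ[ℝ] A) (hG : B6SectA.deltaA lapV grad dv P (Qpp ∘ₗ Qv) Qs a ∘ₗ G = LinearMap.id)
    (hP : W →ₗ[ℝ] B) (hPs : B →ₗ[ℝ] W) (hH : ∀ (w : W) (b : B), ⟪hP w, b⟫_ℝ = ⟪w, hPs b⟫_ℝ)
    (ε : N1 →ₗ[ℝ] W) (Qp : B →ₗ[ℝ] W) (hQpH : Qp ∘ₗ hP = LinearMap.id) (d1 : W →ₗ[ℝ] Bs)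
    (h2103 : ∀ b : B, Qv (grad b) = d1 (Qp b)) (h2104 : ∀ ω : N1, Qpp (d1 (ε ω)) = 0)
    (horth : ∀ (n : Nj) (w : W), ⟪lap (ι n), lap (hP w)⟫_ℝ = 0) (hκ : ∀ ω : N1, ∃ m₀ : NQ, κ m₀ = hP (ε ω))
    (C : W →ₗ[ℝ] W) (TC : W →ₗ[ℝ] N1) (hC : ∀ x y : W, ⟪C x, y⟫_ℝ = ⟪x, C y⟫_ℝ) (hCr : ∀ s, C s = ε (TC s))
    (hCsol : ∀ (ω : N1) (s : W), ⟪ε ω, (hPs ∘ₗ lap ∘ₗ lap ∘ₗ hP) (C s)⟫_ℝ = ⟪ε ω, s⟫_ℝ)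
    (hZC : ∫ ω, Real.exp (-(1 / 2) * ⟪ε ω, (hPs ∘ₗ lap ∘ₗ lap ∘ₗ hP) (ε ω)⟫_ℝ) ∂ν ≠ 0)
    (cX : ℝ) (hX : ∀ v : A, ∫ m, Real.exp (-(1 / 2) * ‖dv v - lap (κ m)‖ ^ 2) ∂μ' =
      cX * ∫ ω, ∫ n, Real.exp (-(1 / 2) * ‖dv v - lap (ι n + hP (ε ω))‖ ^ 2) ∂μj ∂ν)
    (hZ' : ∫ m, Real.exp (-(1 / 2) * ‖lap (κ m)‖ ^ 2) ∂μ' ≠ 0)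
    (hZj : ∫ n, Real.exp (-(1 / 2) * ‖lap (ι n)‖ ^ 2) ∂μj ≠ 0)
    (σ : S →ₗ[ℝ] A) (e₁ : (N1 × S) ≃L[ℝ] A) (he₁ : ∀ (ω : N1) (s : S), e₁ (ω, s) = σ s - grad (hP (ε ω)))
    (ιB : NB →ₗ[ℝ] Bs) (ιA : N →ₗ[ℝ] A) (Hj : Bs →ₗ[ℝ] A) (hιA : ∀ n, Qv (ιA n) = 0) (hHj : ∀ b, Qv (Hj b) = b)
    (e₂ : (NB × N) ≃L[ℝ] S) (he₂ : ∀ (m : NB) (n : N), σ (e₂ (m, n)) = ιA n + Hj (ιB m))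

include νB μN hlap hK hPK hKj hRj hPj hlapVsym hlapV hgrad hΔ hcurl hQ ha hG hH hQpH h2103 h2104 horth hκ hC hCr hCsol
  hZC hX hZ' hZj he₁ hιA hHj he₂

/-- **(2.95) ⇒ (2.112)** (pp. 240–243), in the finite-dimensional Haar model.  Starting from the Gaussian representation
(2.95) of `G = Δ_a⁻¹` (`…B6Eq295.eq295_first`: `e^{½⟨J,GJ⟩}·Z = ∫dA exp[−½⟨QA,aQA⟩ − ½⟨A,(Δ−∂P∂*)A⟩ + ⟨A,J⟩]`, `hint₁` its
absolute convergence), the steps *"the identity (1.27) valid for this operator P also"*, (2.96) (the change of variables `e₁`),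
*"apply (2.96) and (1.27) to the denominator"* (2.97), the gauge transformation `A → A − ∂H′_jω` (2.105), (2.106), *"Calculating
these integrals we get (2.111)"*, and `dA = dB·dA↾{Q_jA = B}` (`e₂`) give
`e^{½⟨J,GJ⟩}·Z = c · e^{½⟨J,K₁J⟩} ∫dB Π_{y∈Λ′}δ_{Ax(y)}(B) e^{−½⟨Q″B,aQ″B⟩} ∫dAδ(Q_jA − B) exp[−½⟨A,(Δ−∂P_j∂*)A⟩ + ⟨A, J − K₂J⟩]`
with `K₁ = ∂H′_jCH′_j*∂*`, `K₂ = ∂ΔH′_jCH′_j*∂*` and `c = c₁⁻¹·(Z′Z′_j⁻¹cX⁻¹)·c₂⁻¹` (`c₁, c₂` the Haar scalar factors of `e₁, e₂`;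
print: `Z⁻¹Z′_j⁻¹Z′` after division by `Z`) — *"This implies further [(2.112)]"*.  Hypotheses as in the module docstring.
[cite: Balaban1984PropagatorsII, (2.95)–(2.97) p.240, (2.103)–(2.106) pp.241–242, (2.111)–(2.112) pp.242–243] -/
theorem eq2112 (J : A)
    (hint₁ : Integrable (fun v : A => Real.exp (-(1 / 2) * ⟪Qpp (Qv v), a (Qpp (Qv v))⟫_ℝ
      - (1 / 2) * ⟪v, (lapV - grad ∘ₗ P ∘ₗ dv) v⟫_ℝ + ⟪v, J⟫_ℝ)) μA)
    (hint₂ : Integrable (fun s : S => Real.exp (-(1 / 2) * ⟪Qpp (Qv (σ s)), a (Qpp (Qv (σ s)))⟫_ℝ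
      - (1 / 2) * ⟪σ s, (lapV - grad ∘ₗ Pj ∘ₗ dv) (σ s)⟫_ℝ
      + ⟪σ s, J - (grad ∘ₗ lap ∘ₗ hP ∘ₗ C ∘ₗ hPs ∘ₗ dv) J⟫_ℝ)) μS) :
    Real.exp ((1 / 2) * ⟪J, G J⟫_ℝ) *
        ∫ v, Real.exp (-(1 / 2) * ⟪Qpp (Qv v), a (Qpp (Qv v))⟫_ℝ - (1 / 2) * ⟪v, (lapV - grad ∘ₗ P ∘ₗ dv) v⟫_ℝ) ∂μA =
      ((Measure.addHaarScalarFactor ((ν.prod μS).map e₁) μA : ℝ)⁻¹ *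
          ((∫ m, Real.exp (-(1 / 2) * ‖lap (κ m)‖ ^ 2) ∂μ') * (∫ n, Real.exp (-(1 / 2) * ‖lap (ι n)‖ ^ 2) ∂μj)⁻¹ *
            cX⁻¹) *
          (Measure.addHaarScalarFactor ((νB.prod μN).map e₂) μS : ℝ)⁻¹) *
        Real.exp ((1 / 2) * ⟪J, (grad ∘ₗ hP ∘ₗ C ∘ₗ hPs ∘ₗ dv) J⟫_ℝ) *
        ∫ m, Real.exp (-(1 / 2) * ⟪Qpp (ιB m), a (Qpp (ιB m))⟫_ℝ) *
          (∫ n, Real.exp (-(1 / 2) * ⟪ιA n + Hj (ιB m), (lapV - grad ∘ₗ Pj ∘ₗ dv) (ιA n + Hj (ιB m))⟫_ℝ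
            + ⟪ιA n + Hj (ιB m), J - (grad ∘ₗ lap ∘ₗ hP ∘ₗ C ∘ₗ hPs ∘ₗ dv) J⟫_ℝ) ∂μN) ∂νB := by
  -- the integrands of (2.95)₁ and of (2.112)
  set F0 : A → ℝ := fun v => Real.exp (-(1 / 2) * ⟪Qpp (Qv v), a (Qpp (Qv v))⟫_ℝ
    - (1 / 2) * ⟪v, (lapV - grad ∘ₗ P ∘ₗ dv) v⟫_ℝ + ⟪v, J⟫_ℝ) with hF0
  set G2 : A → ℝ := fun v => Real.exp (-(1 / 2) * ⟪Qpp (Qv v), a (Qpp (Qv v))⟫_ℝ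
    - (1 / 2) * ⟪v, (lapV - grad ∘ₗ Pj ∘ₗ dv) v⟫_ℝ + ⟪v, J - (grad ∘ₗ lap ∘ₗ hP ∘ₗ C ∘ₗ hPs ∘ₗ dv) J⟫_ℝ) with hG2
  set c₁ : NNReal := Measure.addHaarScalarFactor ((ν.prod μS).map e₁) μA with hc₁
  set c₂ : NNReal := Measure.addHaarScalarFactor ((νB.prod μN).map e₂) μS with hc₂
  -- (2.95), first equality
  have hsym := deltaA_symm K P hPK lapV grad dv (Qpp ∘ₗ Qv) Qs a hlapVsym hgrad hQ ha
  have h295 := B6Eq295.eq295_first μA lapV G grad dv P (Qpp ∘ₗ Qv) Qs a hQ hsym hG J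
  simp only [LinearMap.coe_comp, Function.comp_apply] at h295
  -- (2.96): the change of variables e₁, and Fubini
  have hc₁pos : 0 < (c₁ : ℝ) := by exact_mod_cast B5ChangeOfGauge123.jacobian_pos ν μS μA e₁
  have hI1 : Integrable (fun p : N1 × S => F0 (e₁ p)) (ν.prod μS) := integrable_comp_equiv ν μS μA e₁ F0 hint₁
  have hcv1 : ∫ p, F0 (e₁ p) ∂(ν.prod μS) = (c₁ : ℝ) • ∫ v, F0 v ∂μA :=
    B5ChangeOfGauge123.integral_comp_slice_orbit ν μS μA e₁ F0
  have hstep1 : ∫ v, F0 v ∂μA = (c₁ : ℝ)⁻¹ * ∫ s, ∫ ω, F0 (e₁ (ω, s)) ∂ν ∂μS := by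
    rw [← integral_prod_symm _ hI1, hcv1, smul_eq_mul, ← mul_assoc, inv_mul_cancel₀ hc₁pos.ne', one_mul]
  -- (2.95) ⇒ (2.97) ⇒ (2.105) pointwise at the configuration A′ − ∂H′_jω
  have hpt : ∀ (ω : N1) (s : S), F0 (e₁ (ω, s)) =
      Real.exp (-(1 / 2) * ⟪Qpp (Qv (σ s)), a (Qpp (Qv (σ s)))⟫_ℝ - (1 / 2) * ‖curl (σ s)‖ ^ 2
          - (1 / 2) * ‖Rj (dv (σ s))‖ ^ 2) * Real.exp ⟪σ s, J⟫_ℝ * Real.exp (-⟪grad (hP (ε ω)), J⟫_ℝ) *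
        ((∫ n, Real.exp (-(1 / 2) * ‖lap (ι n)‖ ^ 2) ∂μj)⁻¹ *
          ∫ n, Real.exp (-(1 / 2) * ‖dv (σ s) - lap (ι n + hP (ε ω))‖ ^ 2) ∂μj) *
        (∫ m, Real.exp (-(1 / 2) * ‖lap (κ m)‖ ^ 2) ∂μ') *
        (∫ m, Real.exp (-(1 / 2) * ‖dv (σ s) - lap (κ m)‖ ^ 2) ∂μ')⁻¹ := by
    intro ω s
    rw [he₁, hF0]
    simp only []
    rw [B6Eq2112.integrand_295_eq_297 μ' μj lap κ ι K hK P hPK Kj hKj Rj hRj lapV curl grad dv hgrad hlapV hZ' hZj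
      _ J (σ s - grad (hP (ε ω)))]
    exact B6Eq2112.integrand_297_eq_2105 μ' μj lap κ ι Kj hKj Rj hRj curl grad dv hΔ hcurl hP ε Qp hQpH Qv d1 Qpp a
      h2103 h2104 horth hκ _ _ J (σ s) ω
  -- (2.105) ⇒ (2.106) ⇒ (2.111): the ω-integral at fixed A′, and the (2.112) integrand
  have hω : ∀ s : S, ∫ ω, F0 (e₁ (ω, s)) ∂ν =
      ((∫ m, Real.exp (-(1 / 2) * ‖lap (κ m)‖ ^ 2) ∂μ') * (∫ n, Real.exp (-(1 / 2) * ‖lap (ι n)‖ ^ 2) ∂μj)⁻¹ * cX⁻¹) *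
        Real.exp ((1 / 2) * ⟪J, (grad ∘ₗ hP ∘ₗ C ∘ₗ hPs ∘ₗ dv) J⟫_ℝ) * G2 (σ s) := by
    intro s
    simp_rw [hpt]
    rw [B6Eq2112.integral_2105_omega ν μj lap ι hP hPs ε grad dv hlap hH hgrad horth C TC hC hCr hCsol hZC J (σ s)
      (B6Eq2112.Zlam_ne_zero μj lap ι Kj hKj Rj hRj hZj (dv (σ s))) _ cX (hX (σ s)) _ _ _,
      B6Eq2112.integrand_2112 Kj Rj Pj hRj hPj lapV curl grad dv hgrad hlapV _ J _ (σ s)]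
  -- dA′ = dB·dA↾{Q_jA = B}: the change of variables e₂, and Fubini
  have hc₂pos : 0 < (c₂ : ℝ) := by exact_mod_cast B5ChangeOfGauge123.jacobian_pos νB μN μS e₂
  have hI2 : Integrable (fun p : NB × N => G2 (σ (e₂ p))) (νB.prod μN) :=
    integrable_comp_equiv νB μN μS e₂ (fun s => G2 (σ s)) hint₂
  have hcv2 : ∫ p, G2 (σ (e₂ p)) ∂(νB.prod μN) = (c₂ : ℝ) • ∫ s, G2 (σ s) ∂μS :=
    B5ChangeOfGauge123.integral_comp_slice_orbit νB μN μS e₂ (fun s => G2 (σ s))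
  have hstep2 : ∫ s, G2 (σ s) ∂μS = (c₂ : ℝ)⁻¹ * ∫ m, ∫ n, G2 (σ (e₂ (m, n))) ∂μN ∂νB := by
    rw [← integral_prod _ hI2, hcv2, smul_eq_mul, ← mul_assoc, inv_mul_cancel₀ hc₂pos.ne', one_mul]
  -- on the fibre {Q_jA = B}: Q″Q_jA = Q″B
  have hfib : ∀ (m : NB) (n : N), G2 (σ (e₂ (m, n))) =
      Real.exp (-(1 / 2) * ⟪Qpp (ιB m), a (Qpp (ιB m))⟫_ℝ) *
        Real.exp (-(1 / 2) * ⟪ιA n + Hj (ιB m), (lapV - grad ∘ₗ Pj ∘ₗ dv) (ιA n + Hj (ιB m))⟫_ℝ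
          + ⟪ιA n + Hj (ιB m), J - (grad ∘ₗ lap ∘ₗ hP ∘ₗ C ∘ₗ hPs ∘ₗ dv) J⟫_ℝ) := by
    intro m n
    rw [he₂, hG2]
    simp only []
    rw [map_add Qv, hιA, hHj, zero_add, ← Real.exp_add]
    congr 1
    ring
  have hinner : ∀ m : NB, ∫ n, G2 (σ (e₂ (m, n))) ∂μN =
      Real.exp (-(1 / 2) * ⟪Qpp (ιB m), a (Qpp (ιB m))⟫_ℝ) *
        ∫ n, Real.exp (-(1 / 2) * ⟪ιA n + Hj (ιB m), (lapV - grad ∘ₗ Pj ∘ₗ dv) (ιA n + Hj (ιB m))⟫_ℝ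
          + ⟪ιA n + Hj (ιB m), J - (grad ∘ₗ lap ∘ₗ hP ∘ₗ C ∘ₗ hPs ∘ₗ dv) J⟫_ℝ) ∂μN := by
    intro m
    simp_rw [hfib]
    exact integral_const_mul _ _
  -- assemble
  rw [← h295, hstep1]
  simp_rw [hω]
  rw [integral_const_mul, hstep2]
  simp_rw [hinner]
  ring

/-! ## §3  (2.112) normalised; (2.119) and (2.129) from (2.95) -/

/-- **(2.112) AS PRINTED (divided by `Z ≠ 0`)** — exactly the displayed hypothesis `h2112` of `…B6GaussianIdentity2119.eq2119`
and `…B6Repr2129.eq2129`, with `E = e^{½⟨J,GJ⟩}` and the constant `c = Z⁻¹·c₁⁻¹·Z′Z′_j⁻¹cX⁻¹·c₂⁻¹` (print: `Z⁻¹Z′_j⁻¹Z′`):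
*"e^{½⟨J,GJ⟩} = e^{½⟨J,∂H′_jCH′_j*∂*J⟩}Z⁻¹Z′_j⁻¹Z′ · ∫dB exp[…]Π_{y∈Λ′}δ_{Ax(y)}(B) · ∫dAδ(Q_jA−B) exp[−½⟨A,(Δ−∂P_j∂*)A⟩
+ ⟨A, J − ∂ΔH′_jCH′_j*∂*J⟩]. (2.112)"* [cite: Balaban1984PropagatorsII, (2.112) p.243] -/
theorem eq2112_normalised (J : A)
    (hint₁ : Integrable (fun v : A => Real.exp (-(1 / 2) * ⟪Qpp (Qv v), a (Qpp (Qv v))⟫_ℝ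
      - (1 / 2) * ⟪v, (lapV - grad ∘ₗ P ∘ₗ dv) v⟫_ℝ + ⟪v, J⟫_ℝ)) μA)
    (hint₂ : Integrable (fun s : S => Real.exp (-(1 / 2) * ⟪Qpp (Qv (σ s)), a (Qpp (Qv (σ s)))⟫_ℝ
      - (1 / 2) * ⟪σ s, (lapV - grad ∘ₗ Pj ∘ₗ dv) (σ s)⟫_ℝ
      + ⟪σ s, J - (grad ∘ₗ lap ∘ₗ hP ∘ₗ C ∘ₗ hPs ∘ₗ dv) J⟫_ℝ)) μS)
    (hZ : ∫ v, Real.exp (-(1 / 2) * ⟪Qpp (Qv v), a (Qpp (Qv v))⟫_ℝ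
      - (1 / 2) * ⟪v, (lapV - grad ∘ₗ P ∘ₗ dv) v⟫_ℝ) ∂μA ≠ 0) :
    Real.exp ((1 / 2) * ⟪J, G J⟫_ℝ) =
      Real.exp ((1 / 2) * ⟪J, (grad ∘ₗ hP ∘ₗ C ∘ₗ hPs ∘ₗ dv) J⟫_ℝ) *
        ((∫ v, Real.exp (-(1 / 2) * ⟪Qpp (Qv v), a (Qpp (Qv v))⟫_ℝ
            - (1 / 2) * ⟪v, (lapV - grad ∘ₗ P ∘ₗ dv) v⟫_ℝ) ∂μA)⁻¹ *
          ((Measure.addHaarScalarFactor ((ν.prod μS).map e₁) μA : ℝ)⁻¹ *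
          ((∫ m, Real.exp (-(1 / 2) * ‖lap (κ m)‖ ^ 2) ∂μ') * (∫ n, Real.exp (-(1 / 2) * ‖lap (ι n)‖ ^ 2) ∂μj)⁻¹ *
            cX⁻¹) *
          (Measure.addHaarScalarFactor ((νB.prod μN).map e₂) μS : ℝ)⁻¹)) *
        ∫ m, Real.exp (-(1 / 2) * ⟪Qpp (ιB m), a (Qpp (ιB m))⟫_ℝ) *
          (∫ n, Real.exp (-(1 / 2) * ⟪ιA n + Hj (ιB m), (lapV - grad ∘ₗ Pj ∘ₗ dv) (ιA n + Hj (ιB m))⟫_ℝ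
            + ⟪ιA n + Hj (ιB m), J - (grad ∘ₗ lap ∘ₗ hP ∘ₗ C ∘ₗ hPs ∘ₗ dv) J⟫_ℝ) ∂μN) ∂νB := by
  have h := eq2112 μA ν μS νB μN μj μ' lap hlap κ ι K hK P hPK Kj hKj Rj Pj hRj hPj lapV curl grad dv hlapVsym
    hlapV hgrad hΔ hcurl Qv Qpp Qs a hQ ha G hG hP hPs hH ε Qp hQpH d1 h2103 h2104 horth hκ C TC hC hCr hCsol hZC cX
    hX hZ' hZj σ e₁ he₁ ιB ιA Hj hιA hHj e₂ he₂ J hint₁ hint₂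
  rw [← mul_inv_cancel_right₀ hZ (Real.exp ((1 / 2) * ⟪J, G J⟫_ℝ)), h]
  ring

/-- **(2.119) p. 243 from (2.95)**: `…B6GaussianIdentity2119.eq2119` with its displayed hypothesis `h2112` DISCHARGED by
`eq2112_normalised`.  The remaining (2.113)–(2.118) data are as there: `G̃_j` a covariance of the `δ(Q_jA)`-Gaussian of
`M = Δ − ∂P_j∂*` in the coordinates `ι_A` (`hGt`, `hsol`), `H_j` critical (`hcrit`) with adjoint `H_j*` (`hadj`), and the
identification (2.116)–(2.118) `⟨H_jB,(Δ−∂P_j∂*)H_jB⟩ = ⟨B,Δ_jB⟩` (`h2118`; discharged by the Faddeev–Popov step in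
`…B6Eq2117FaddeevPopov`/`…B6Eq2129FaddeevPopov`).  Conclusion, AS PRINTED: *"e^{½⟨J,GJ⟩} = exp[½⟨J,∂H′_jCH′_j*∂*J⟩ +
½⟨J − ∂ΔH′_jCH′_j*∂*J, G̃_j(J − …)⟩] · Z″⁻¹∫dB Πδ_{Ax(y)}(B) exp[−½⟨Q″B,aQ″B⟩ − ½⟨B,Δ_jB⟩ + ⟨B,H_j*(J − …)⟩] (2.119)"* with
`Z″⁻¹ = c·Z̃_j`. [cite: Balaban1984PropagatorsII, (2.119) p.243] -/
theorem eq2119_of_295 (J : A)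
    (hint₁ : Integrable (fun v : A => Real.exp (-(1 / 2) * ⟪Qpp (Qv v), a (Qpp (Qv v))⟫_ℝ
      - (1 / 2) * ⟪v, (lapV - grad ∘ₗ P ∘ₗ dv) v⟫_ℝ + ⟪v, J⟫_ℝ)) μA)
    (hint₂ : Integrable (fun s : S => Real.exp (-(1 / 2) * ⟪Qpp (Qv (σ s)), a (Qpp (Qv (σ s)))⟫_ℝ
      - (1 / 2) * ⟪σ s, (lapV - grad ∘ₗ Pj ∘ₗ dv) (σ s)⟫_ℝ
      + ⟪σ s, J - (grad ∘ₗ lap ∘ₗ hP ∘ₗ C ∘ₗ hPs ∘ₗ dv) J⟫_ℝ)) μS)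
    (hZ : ∫ v, Real.exp (-(1 / 2) * ⟪Qpp (Qv v), a (Qpp (Qv v))⟫_ℝ
      - (1 / 2) * ⟪v, (lapV - grad ∘ₗ P ∘ₗ dv) v⟫_ℝ) ∂μA ≠ 0)
    (Gt : A →ₗ[ℝ] A) (Tt : A →ₗ[ℝ] N) (hGt : ∀ J', Gt J' = ιA (Tt J'))
    (hsol : ∀ (n : N) (J' : A), ⟪ιA n, (lapV - grad ∘ₗ Pj ∘ₗ dv) (Gt J')⟫_ℝ = ⟪ιA n, J'⟫_ℝ)
    (hcrit : ∀ (b : Bs) (v : A), Qv v = 0 → ⟪v, (lapV - grad ∘ₗ Pj ∘ₗ dv) (Hj b)⟫_ℝ = 0)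
    (Hjs : A →ₗ[ℝ] Bs) (hadj : ∀ (b : Bs) (x : A), ⟪Hj b, x⟫_ℝ = ⟪b, Hjs x⟫_ℝ) (Δj : Bs →ₗ[ℝ] Bs)
    (h2118 : ∀ b : Bs, ⟪Hj b, (lapV - grad ∘ₗ Pj ∘ₗ dv) (Hj b)⟫_ℝ = ⟪b, Δj b⟫_ℝ) :
    Real.exp ((1 / 2) * ⟪J, G J⟫_ℝ) =
      Real.exp ((1 / 2) * ⟪J, (grad ∘ₗ hP ∘ₗ C ∘ₗ hPs ∘ₗ dv) J⟫_ℝ +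
          (1 / 2) * ⟪J - (grad ∘ₗ lap ∘ₗ hP ∘ₗ C ∘ₗ hPs ∘ₗ dv) J,
            Gt (J - (grad ∘ₗ lap ∘ₗ hP ∘ₗ C ∘ₗ hPs ∘ₗ dv) J)⟫_ℝ) *
        (((∫ v, Real.exp (-(1 / 2) * ⟪Qpp (Qv v), a (Qpp (Qv v))⟫_ℝ
            - (1 / 2) * ⟪v, (lapV - grad ∘ₗ P ∘ₗ dv) v⟫_ℝ) ∂μA)⁻¹ *
          ((Measure.addHaarScalarFactor ((ν.prod μS).map e₁) μA : ℝ)⁻¹ *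
          ((∫ m, Real.exp (-(1 / 2) * ‖lap (κ m)‖ ^ 2) ∂μ') * (∫ n, Real.exp (-(1 / 2) * ‖lap (ι n)‖ ^ 2) ∂μj)⁻¹ *
            cX⁻¹) *
          (Measure.addHaarScalarFactor ((νB.prod μN).map e₂) μS : ℝ)⁻¹)) *
          ∫ n, Real.exp (-(1 / 2) * ⟪ιA n, (lapV - grad ∘ₗ Pj ∘ₗ dv) (ιA n)⟫_ℝ) ∂μN) *
        ∫ m, Real.exp (-(1 / 2) * ⟪Qpp (ιB m), a (Qpp (ιB m))⟫_ℝ - (1 / 2) * ⟪ιB m, Δj (ιB m)⟫_ℝ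
          + ⟪ιB m, Hjs (J - (grad ∘ₗ lap ∘ₗ hP ∘ₗ C ∘ₗ hPs ∘ₗ dv) J)⟫_ℝ) ∂νB :=
  B6GaussianIdentity2119.eq2119 μN ιA (lapV - grad ∘ₗ Pj ∘ₗ dv) Gt Tt Qv Hj Hjs Δj
    (Mj_symm Kj Pj hPj lapV grad dv hlapVsym hgrad) hιA hcrit hGt hsol hadj h2118 νB ιB Qpp a
    (grad ∘ₗ hP ∘ₗ C ∘ₗ hPs ∘ₗ dv) (grad ∘ₗ lap ∘ₗ hP ∘ₗ C ∘ₗ hPs ∘ₗ dv) J _ _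
    (eq2112_normalised μA ν μS νB μN μj μ' lap hlap κ ι K hK P hPK Kj hKj Rj Pj hRj hPj lapV curl grad dv
      hlapVsym hlapV hgrad hΔ hcurl Qv Qpp Qs a hQ ha G hG hP hPs hH ε Qp hQpH d1 h2103 h2104 horth hκ C TC hC hCr
      hCsol hZC cX hX hZ' hZj σ e₁ he₁ ιB ιA Hj hιA hHj e₂ he₂ J hint₁ hint₂ hZ)

/-- **(2.129) p. 246 from (2.95)**: `…B6Repr2129.eq2129` (*"We may calculate the integral in (2.119), and we get finally the
desired identity ⟨J,GJ⟩ = ⟨J,∂H′_jCH′_j*∂*J⟩ + ⟨J − ∂ΔH′_jCH′_j*∂*J, (G̃_j + H_jC̃^{(j)}_ΛH_j*)(J − ∂ΔH′_jCH′_j*∂*J)⟩ (2.129)"*) with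
its displayed hypothesis `h2112` DISCHARGED by `eq2112_normalised` for every source `J` (the integrability hypotheses are
therefore quantified over `J`); the B-Gaussian data (`C̃^{(j)}_Λ = Ct` a covariance of the `Πδ_{Ax}`-Gaussian of `Q″*aQ″ + Δ_j`
in the coordinates `ι_B`, `Q″*` the adjoint of `Q″`, `a` and `Δ_j` symmetric) as there. [cite: Balaban1984PropagatorsII, (2.129) p.246] -/
theorem eq2129_of_295
    (hint₁ : ∀ J : A, Integrable (fun v : A => Real.exp (-(1 / 2) * ⟪Qpp (Qv v), a (Qpp (Qv v))⟫_ℝ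
      - (1 / 2) * ⟪v, (lapV - grad ∘ₗ P ∘ₗ dv) v⟫_ℝ + ⟪v, J⟫_ℝ)) μA)
    (hint₂ : ∀ J : A, Integrable (fun s : S => Real.exp (-(1 / 2) * ⟪Qpp (Qv (σ s)), a (Qpp (Qv (σ s)))⟫_ℝ
      - (1 / 2) * ⟪σ s, (lapV - grad ∘ₗ Pj ∘ₗ dv) (σ s)⟫_ℝ
      + ⟪σ s, J - (grad ∘ₗ lap ∘ₗ hP ∘ₗ C ∘ₗ hPs ∘ₗ dv) J⟫_ℝ)) μS)
    (hZ : ∫ v, Real.exp (-(1 / 2) * ⟪Qpp (Qv v), a (Qpp (Qv v))⟫_ℝ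
      - (1 / 2) * ⟪v, (lapV - grad ∘ₗ P ∘ₗ dv) v⟫_ℝ) ∂μA ≠ 0)
    (Gt : A →ₗ[ℝ] A) (Tt : A →ₗ[ℝ] N) (hGt : ∀ J', Gt J' = ιA (Tt J'))
    (hsol : ∀ (n : N) (J' : A), ⟪ιA n, (lapV - grad ∘ₗ Pj ∘ₗ dv) (Gt J')⟫_ℝ = ⟪ιA n, J'⟫_ℝ)
    (hcrit : ∀ (b : Bs) (v : A), Qv v = 0 → ⟪v, (lapV - grad ∘ₗ Pj ∘ₗ dv) (Hj b)⟫_ℝ = 0)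
    (Hjs : A →ₗ[ℝ] Bs) (hadj : ∀ (b : Bs) (x : A), ⟪Hj b, x⟫_ℝ = ⟪b, Hjs x⟫_ℝ) (Δj : Bs →ₗ[ℝ] Bs)
    (h2118 : ∀ b : Bs, ⟪Hj b, (lapV - grad ∘ₗ Pj ∘ₗ dv) (Hj b)⟫_ℝ = ⟪b, Δj b⟫_ℝ)
    (TB : Bs →ₗ[ℝ] NB) (Qpps : V →ₗ[ℝ] Bs) (Ct : Bs →ₗ[ℝ] Bs)
    (hQpp : ∀ (w : V) (b : Bs), ⟪Qpps w, b⟫_ℝ = ⟪w, Qpp b⟫_ℝ) (hΔj : ∀ x y : Bs, ⟪Δj x, y⟫_ℝ = ⟪x, Δj y⟫_ℝ)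
    (hCt : ∀ K', Ct K' = ιB (TB K'))
    (hCtsol : ∀ (m : NB) (K' : Bs), ⟪ιB m, (Qpps ∘ₗ a ∘ₗ Qpp + Δj) (Ct K')⟫_ℝ = ⟪ιB m, K'⟫_ℝ) (J : A) :
    ⟪J, G J⟫_ℝ = ⟪J, (grad ∘ₗ hP ∘ₗ C ∘ₗ hPs ∘ₗ dv) J⟫_ℝ +
      ⟪J - (grad ∘ₗ lap ∘ₗ hP ∘ₗ C ∘ₗ hPs ∘ₗ dv) J,
        (Gt + Hj ∘ₗ Ct ∘ₗ Hjs) (J - (grad ∘ₗ lap ∘ₗ hP ∘ₗ C ∘ₗ hPs ∘ₗ dv) J)⟫_ℝ :=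
  B6Repr2129.eq2129 μN ιA (lapV - grad ∘ₗ Pj ∘ₗ dv) Gt Tt Qv Hj Hjs Δj
    (Mj_symm Kj Pj hPj lapV grad dv hlapVsym hgrad) hιA hcrit hGt hsol hadj h2118 νB ιB TB Qpp Qpps a Ct hQpp ha hΔj
    hCt hCtsol G (grad ∘ₗ hP ∘ₗ C ∘ₗ hPs ∘ₗ dv) (grad ∘ₗ lap ∘ₗ hP ∘ₗ C ∘ₗ hPs ∘ₗ dv) _
    (fun J' => eq2112_normalised μA ν μS νB μN μj μ' lap hlap κ ι K hK P hPK Kj hKj Rj Pj hRj hPj lapV curl grad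
      dv hlapVsym hlapV hgrad hΔ hcurl Qv Qpp Qs a hQ ha G hG hP hPs hH ε Qp hQpH d1 h2103 h2104 horth hκ C TC hC
      hCr hCsol hZC cX hX hZ' hZj σ e₁ he₁ ιB ιA Hj hιA hHj e₂ he₂ J' (hint₁ J') (hint₂ J') hZ) J

end Model

end Literature.MathematicalPhysics.QuantumFieldTheory.Balaban1983to89.B6Eq2112Assembly

end
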